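import Summits.Ventures.QEC.CircuitDistance.SchedLeavesBB144o345X
import Summits.Ventures.QEC.CircuitDistance.SchedLeafTransport345
import HarnessLib

/-!
# Q4 #345 (`sched345`): Z-SIDE TRANSPORT CHECKS of the X leaf entries, part 30 of 31 (cell `qec`, experiment CDX; seat qec-cdx-eng-1 g3)

Per X entry `e` of `o345XLeaves` (repaired entries in their `…r` form): `zTransportChecks345 e = true` (type-2/idea-2 `SchedLeafTransport345`:
`o345ZTable.covers₂` of the Φ-relabelled entry `transportEntry345 e` and the detector bound `detBound345 e`) by `decide +kernel`; then
`okZ_<group>` over the aggregator's per-file lists `L_<group>` — the `hchk` hypothesis of `sched345_circuitDistance_eq_eleven_of_xLeaves` is their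
concatenation (`SchedLeavesBB144o345XZ`). Z sector by the certified X↔Z duality of order #345; no Z leaf files. No `native_decide`.
-/

namespace Summit.Ventures.QEC.CircuitDistance

set_option maxRecDepth 100000 in
set_option maxHeartbeats 4000000000 in
/-- KERNEL: the transported (Z-side) checks of `e345X9_4` pass. -/
theorem e345X9_4_zchk : zTransportChecks345 e345X9_4 = true := by decide +kernel

/-- every entry of `L_SchedLeavesBB144o345X9_4` passes the Z-side transport checks. -/
theorem okZ_SchedLeavesBB144o345X9_4 : ∀ e ∈ L_SchedLeavesBB144o345X9_4, zTransportChecks345 e = true := by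
  intro e he
  simp only [L_SchedLeavesBB144o345X9_4, List.mem_cons, List.not_mem_nil, or_false] at he
  subst he; exact e345X9_4_zchk

end Summit.Ventures.QEC.CircuitDistance
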